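import Mathlib
import HarnessLib
import Summits.HubbardSuperconductivity.HubbardSuperconductivity.Theorems.KLProgrammeKLRegimeEnginePairTransferPPRateWindow
import Summits.HubbardSuperconductivity.HubbardSuperconductivity.Theorems.KLProgrammeKLRegimeEnginePairTransferMemberDefectLocSplit

/-!
# Route `KLProgramme` — ENGINE item stmt-HubbardSuperconductivity-20437 `KLRegimeEngineV17F2`, row (c) package θ, binder row `hLr` (the localisation remainder `RL`):
# PRODUCER-SIDE BRICK 3 — row `hLr` from SINGLE-KERNEL frequency-PINNING profiles (k3c1-p1's localisation split `klmd_loc_le_rows` ∘ the pp rate-kernel masses)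
# (cell gate-hubbard-kl, seat hubbard-kl-k3c2-p2 g29, technique «thermal-bar induction n ≤ nScales β + 1 with EngineBoundsAtV4S sums»)

WHY.  Bricks 1/2 (…PPRateSupport / …PPRateWindow) deliver θ's row `hLr` from a modulus (profile) of the PRODUCT bracket `V(ω₀)V(ω₀) − V(ω)V(ω)`.  The E1 statement a
producer proves is about ONE kernel: the frequency-PINNING difference `‖V[(ω₀,k)…] − V[(ω,k)…]‖` of the dressed quartic kernel in one external leg pair (BGM 2006 §2.6–2.8
`(1 − ℒ)`, gain `|ω − ω₀|·‖∂_ωV‖`).  k3c1-p1's model-free localisation split `klmd_loc_le_rows` (…MemberDefectLocSplit, p617612, row 42 of KLTC-INDEX v10) turns the product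
bracket into `𝟙ball·(δ₁·Mv + Mv·δ₂) + 𝟙off·Mv²` pointwise (kernel sup `Mv`, pinning moduli `δ₁ δ₂`); on the support of `Br` the off-ball term VANISHES
(`klpr_rate_eq_zero_of_not_mem_ball`) and the weighted mass `Σ_z ‖Br z‖·κ(z)` of a window PROFILE `κ` is read by the total / window masses.  So:
* `klpr_sum_norm_rate_mul_profile_le` — `κ z ≤ ε + Σ_w 𝟙[|z.1 − cen w|_𝕋 ≤ ρw w]·A w` where `Br z ≠ 0` ⇒ `Σ_z ‖Br z‖·κ z ≤ 2¹⁰·15367·ε + Σ_w 2¹⁰·15381(ρw w/π + 1/L)·A w`;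
* **`klpr_hLr_of_pinningProfiles`** — kernel sup `‖V j t X‖ ≤ Mv` (θ's `hrow`: `Mv = c₄U`) and ONE pinning-profile row
  `‖V(p₁) − V(r₁)‖ + ‖V(p₂) − V(r₂)‖ ≤ ε + Σ_w 𝟙[|z.1 − cen w|_𝕋 ≤ ρw w]·A w` for `z.1 ∈ klBall L μ 0`, `ω_{z.2}² ≤ (4Λₙ₊₁)²` (the two leg pairs of θ's `hLr`) ⇒ θ's LITERAL
  `hLr` bracket `≤ Mv·(2¹⁰·15367·ε + Σ_w 2¹⁰·15381(ρw w/π + 1/L)·A w)`.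
With this the (L) group of binder #9 is reduced to the SAME single-kernel frequency-pinning statement that k3c1's in-class rows `RL₁ RL₂` consume (KLTC-INDEX v10 §D) — one E1
statement serves both lineages.  Real analysis over landed rows; `V` arbitrary; nothing asserts (c), K3 or superconductivity.  0 kit · 0 lit.
-/

noncomputable section

namespace Summit.HubbardSuperconductivity.HubbardSuperconductivity.Theorems.KLRegimeSplit

set_option linter.dupNamespace false -- summit = problem name (single-conjunct summit), D-0017

open Real Set Finset Complex Literature.MathematicalPhysics.QuantumLattice
open Literature.Probability.LatticeModels hiding torusSupNorm
open Summit.HubbardSuperconductivity.HubbardSuperconductivity.Theorems.KLProgrammeLegKernels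
open Summit.HubbardSuperconductivity.HubbardSuperconductivity.Theorems.KLRegimeWick
open Summit.HubbardSuperconductivity.HubbardSuperconductivity.Theorems.TwoPointAssembly
open Summit.HubbardSuperconductivity.HubbardSuperconductivity.Theorems.DispersionFlow
open Summit.HubbardSuperconductivity.HubbardSuperconductivity.Theorems.EngineV8

variable {L M : ℕ} [NeZero L] (β μ : ℝ) (K : TrigPolyC4v) {R : RenConsts} {U : ℝ} {N : ℕ}

/-- **Weighted mass of the pp rate kernel against a window PROFILE**: `κ z ≤ ε + Σ_w 𝟙[|z.1 − cen w|_𝕋 ≤ ρw w]·A w` wherever `Br j Qm t z ≠ 0`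
(`ε, A w, ρw w ≥ 0`) ⇒ `Σ_z ‖Br j Qm t z‖·κ z ≤ 2¹⁰·15367·ε + Σ_w 2¹⁰·15381·(ρw w/π + 1/L)·A w` (total mass off the windows, window mass on each). -/
theorem klpr_sum_norm_rate_mul_profile_le (hK : FrameOK R U N μ K) (hβ : klBetaMin ≤ β) (hβL : β ≤ L) (n : ℕ) {t : ℝ} (ht : t ∈ Icc (0 : ℝ) 1)
    (Φ : ℕ → ℝ → FreqMomentum L M → ℝ)
    (hΦ : Φ = fun j t k => (softSymbolCompl L M β μ K (n + 1) j) k + (hubbardCutoffWeightCT L M β μ K (klScale klE0 (n + 1)) k -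
        hubbardCutoffWeightCT L M β μ K (klScale klE0 n + t * (klScale klE0 (n + 1) - klScale klE0 n)) k))
    (Wd : ℝ → FreqMomentum L M → ℝ)
    (hWd : Wd = fun t k => deriv (fun Λ' : ℝ => hubbardCutoffWeightCT L M β μ K Λ' k) (klScale klE0 n + t * (klScale klE0 (n + 1) - klScale klE0 n)))
    (Br : ℕ → TorusSite 2 L → ℝ → TorusSite 2 L × MatsubaraIdx M → ℂ)
    (hBr : Br = fun j Qm t z => -(((((β * (L : ℝ) ^ 2 : ℝ) : ℂ)))⁻¹ * propCT L M β μ K (z.2, z.1) * propCT L M β μ K (z.2.rev, Qm - z.1)) *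
      ((((klScale klE0 (n + 1) - klScale klE0 n) * (-Wd t (z.2, z.1) * Φ j t (z.2.rev, Qm - z.1) - Φ j t (z.2, z.1) * Wd t (z.2.rev, Qm - z.1))) : ℝ) : ℂ))
    {j : ℕ} (hj : n + 1 ≤ j) (Qm : TorusSite 2 L)
    {Nw : ℕ} (cen : Fin Nw → TorusSite 2 L) (ρw A : Fin Nw → ℝ) (hρw : ∀ w, 0 ≤ ρw w) (hA : ∀ w, 0 ≤ A w) {ε : ℝ} (hε : 0 ≤ ε)
    (κ : TorusSite 2 L × MatsubaraIdx M → ℝ)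
    (hκ : ∀ z, Br j Qm t z ≠ 0 → κ z ≤ ε + ∑ w, (if klTorusNorm L (z.1 - cen w) ≤ ρw w then A w else 0)) :
    ∑ z : TorusSite 2 L × MatsubaraIdx M, ‖Br j Qm t z‖ * κ z ≤
      (2 : ℝ) ^ 10 * 15367 * ε + ∑ w, (2 : ℝ) ^ 10 * 15381 * (ρw w / π + ((L : ℝ))⁻¹) * A w := by
  classical
  have htot := klpr_sum_norm_rate_le β μ K hK hβ hβL n ht Φ hΦ Wd hWd Br hBr hj Qm
  have hwin := fun w => klpr_sum_window_norm_rate_le β μ K hK hβ hβL n ht Φ hΦ Wd hWd Br hBr hj Qm (cen w) (hρw w)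
  have hpt : ∀ z, ‖Br j Qm t z‖ * κ z ≤ ‖Br j Qm t z‖ * (ε + ∑ w, if klTorusNorm L (z.1 - cen w) ≤ ρw w then A w else 0) := by
    intro z
    by_cases hz : Br j Qm t z = 0
    · rw [hz, norm_zero, zero_mul, zero_mul]
    exact mul_le_mul_of_nonneg_left (hκ z hz) (norm_nonneg _)
  calc ∑ z : TorusSite 2 L × MatsubaraIdx M, ‖Br j Qm t z‖ * κ z
      ≤ ∑ z : TorusSite 2 L × MatsubaraIdx M, ‖Br j Qm t z‖ * (ε + ∑ w, if klTorusNorm L (z.1 - cen w) ≤ ρw w then A w else 0) :=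
        sum_le_sum fun z _ => hpt z
    _ = ε * ∑ z : TorusSite 2 L × MatsubaraIdx M, ‖Br j Qm t z‖ +
          ∑ w, A w * ∑ z ∈ (univ : Finset (TorusSite 2 L × MatsubaraIdx M)).filter (fun z => klTorusNorm L (z.1 - cen w) ≤ ρw w), ‖Br j Qm t z‖ := by
        simp only [mul_add, sum_add_distrib, Finset.mul_sum, sum_filter, mul_ite, mul_zero]
        rw [sum_comm]
        congr 1
        · exact sum_congr rfl fun z _ => mul_comm _ _
        · exact sum_congr rfl fun w _ => sum_congr rfl fun z _ => by split_ifs <;> ring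
    _ ≤ ε * ((2 : ℝ) ^ 10 * 15367) + ∑ w, A w * ((2 : ℝ) ^ 10 * 15381 * (ρw w / π + ((L : ℝ))⁻¹)) :=
        add_le_add (mul_le_mul_of_nonneg_left htot hε) (sum_le_sum fun w _ => mul_le_mul_of_nonneg_left (hwin w) (hA w))
    _ = (2 : ℝ) ^ 10 * 15367 * ε + ∑ w, (2 : ℝ) ^ 10 * 15381 * (ρw w / π + ((L : ℝ))⁻¹) * A w := by
        congr 1
        · ring
        · exact sum_congr rfl fun w _ => by ring

variable [NeZero M]

/-- **ROW `hLr` FROM SINGLE-KERNEL FREQUENCY-PINNING PROFILES.**  `FrameOK` frame with ball data (`|K(p)| ≤ A₀`, `Λₙ + A₀ ≤ e₀`), `klBetaMin ≤ β ≤ L`, member `j ≥ n+1`,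
`t ∈ [0,1]`; ANY leg functional `V` with a kernel sup `‖V j t X‖ ≤ Mv` (θ's `hrow`: `Mv = c₄U`) and ONE pinning-profile row for the two leg pairs of θ's `hLr`
(`p₁/r₁` = first factor pinned/resolved, `p₂/r₂` = second): `‖V(p₁) − V(r₁)‖ + ‖V(p₂) − V(r₂)‖ ≤ ε + Σ_w 𝟙[|z.1 − cen w|_𝕋 ≤ ρw w]·A w` for `z.1 ∈ klBall L μ 0`,
`ω_{z.2}² ≤ (4Λₙ₊₁)²` ⇒ `‖Σ_z Br j Qm t z·(𝟙[z.1 ∈ ball]·V(p₁)V(p₂) − V(r₁)V(r₂))‖ ≤ Mv·(2¹⁰·15367·ε + Σ_w 2¹⁰·15381(ρw w/π + 1/L)·A w)` — k3c1-p1's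
`klmd_loc_le_rows` pointwise, the off-ball term killed by `klpr_rate_eq_zero_of_not_mem_ball`, the profile read by `klpr_sum_norm_rate_mul_profile_le`. -/
theorem klpr_hLr_of_pinningProfiles (hK : FrameOK R U N μ K) (hβ : klBetaMin ≤ β) (hβL : β ≤ L) (n : ℕ) {t : ℝ} (ht : t ∈ Icc (0 : ℝ) 1)
    {A₀ : ℝ} (hKA : ∀ k : TorusSite 2 L, |K.eval (latticeMomentum L k)| ≤ A₀) (hA₀ : klScale klE0 n + A₀ ≤ klE0)
    (V : ℕ → ℝ → (Fin 4 → HubbardFieldIdx L M) → ℂ)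
    (Φ : ℕ → ℝ → FreqMomentum L M → ℝ)
    (hΦ : Φ = fun j t k => (softSymbolCompl L M β μ K (n + 1) j) k + (hubbardCutoffWeightCT L M β μ K (klScale klE0 (n + 1)) k -
        hubbardCutoffWeightCT L M β μ K (klScale klE0 n + t * (klScale klE0 (n + 1) - klScale klE0 n)) k))
    (Wd : ℝ → FreqMomentum L M → ℝ)
    (hWd : Wd = fun t k => deriv (fun Λ' : ℝ => hubbardCutoffWeightCT L M β μ K Λ' k) (klScale klE0 n + t * (klScale klE0 (n + 1) - klScale klE0 n)))
    (Br : ℕ → TorusSite 2 L → ℝ → TorusSite 2 L × MatsubaraIdx M → ℂ)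
    (hBr : Br = fun j Qm t z => -(((((β * (L : ℝ) ^ 2 : ℝ) : ℂ)))⁻¹ * propCT L M β μ K (z.2, z.1) * propCT L M β μ K (z.2.rev, Qm - z.1)) *
      ((((klScale klE0 (n + 1) - klScale klE0 n) * (-Wd t (z.2, z.1) * Φ j t (z.2.rev, Qm - z.1) - Φ j t (z.2, z.1) * Wd t (z.2.rev, Qm - z.1))) : ℝ) : ℂ))
    {j : ℕ} (hj : n + 1 ≤ j) (Qm x y : TorusSite 2 L) {Mv : ℝ} (hM : ∀ X, ‖V j t X‖ ≤ Mv)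
    {Nw : ℕ} (cen : Fin Nw → TorusSite 2 L) (ρw A : Fin Nw → ℝ) (hρw : ∀ w, 0 ≤ ρw w) (hA : ∀ w, 0 ≤ A w) {ε : ℝ} (hε : 0 ≤ ε)
    (hpin : ∀ z : TorusSite 2 L × MatsubaraIdx M, z.1 ∈ klBall L μ 0 → matsubaraFreq β M z.2 ^ 2 ≤ (4 * klScale klE0 (n + 1)) ^ 2 →
      ‖V j t ![(((omega0 M, z.1), 0), 0), ((((omega0 M).rev, Qm - z.1), 1), 0), ((((omega0 M).rev, Qm - x), 1), 1), (((omega0 M, x), 0), 1)] -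
          V j t ![(((z.2, z.1), 0), 0), (((z.2.rev, Qm - z.1), 1), 0), ((((omega0 M).rev, Qm - x), 1), 1), (((omega0 M, x), 0), 1)]‖ +
        ‖V j t ![(((omega0 M, y), 0), 0), ((((omega0 M).rev, Qm - y), 1), 0), ((((omega0 M).rev, Qm - z.1), 1), 1), (((omega0 M, z.1), 0), 1)] -
          V j t ![(((omega0 M, y), 0), 0), ((((omega0 M).rev, Qm - y), 1), 0), (((z.2.rev, Qm - z.1), 1), 1), (((z.2, z.1), 0), 1)]‖ ≤
        ε + ∑ w, (if klTorusNorm L (z.1 - cen w) ≤ ρw w then A w else 0)) :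
    ‖∑ z : TorusSite 2 L × MatsubaraIdx M, Br j Qm t z * ((if z.1 ∈ klBall L μ 0 then V j t ![(((omega0 M, z.1), 0), 0), ((((omega0 M).rev, Qm - z.1), 1), 0), ((((omega0 M).rev, Qm - x), 1), 1), (((omega0 M, x), 0), 1)] * V j t ![(((omega0 M, y), 0), 0), ((((omega0 M).rev, Qm - y), 1),
                  0), ((((omega0 M).rev, Qm - z.1), 1), 1), (((omega0 M, z.1), 0), 1)] else 0) - V j t ![(((z.2, z.1), 0), 0), (((z.2.rev, Qm - z.1), 1), 0), ((((omega0 M).rev, Qm - x), 1), 1), (((omega0 M, x), 0), 1)] * V j t ![(((omega0 M, y), 0), 0), ((((omega0 M).rev, Qm - y), 1), 0), (((z.2.rev, Qm - z.1), 1),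
                  1), (((z.2, z.1), 0), 1)])‖ ≤
      Mv * ((2 : ℝ) ^ 10 * 15367 * ε + ∑ w, (2 : ℝ) ^ 10 * 15381 * (ρw w / π + ((L : ℝ))⁻¹) * A w) := by
  classical
  have hM0 : 0 ≤ Mv := (norm_nonneg _).trans (hM fun _ => (((omega0 M, x), 0), 0))
  -- k3c1-p1's localisation split with the pinning moduli taken to be the differences themselves
  have hloc := klmd_loc_le_rows L M μ Qm x y (V j t) (Br j Qm t) (fun z =>
      ‖V j t ![(((omega0 M, z.1), 0), 0), ((((omega0 M).rev, Qm - z.1), 1), 0), ((((omega0 M).rev, Qm - x), 1), 1), (((omega0 M, x), 0), 1)] -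
          V j t ![(((z.2, z.1), 0), 0), (((z.2.rev, Qm - z.1), 1), 0), ((((omega0 M).rev, Qm - x), 1), 1), (((omega0 M, x), 0), 1)]‖)
    (fun z => ‖V j t ![(((omega0 M, y), 0), 0), ((((omega0 M).rev, Qm - y), 1), 0), ((((omega0 M).rev, Qm - z.1), 1), 1), (((omega0 M, z.1), 0), 1)] -
          V j t ![(((omega0 M, y), 0), 0), ((((omega0 M).rev, Qm - y), 1), 0), (((z.2.rev, Qm - z.1), 1), 1), (((z.2, z.1), 0), 1)]‖)
    hM (fun z => le_rfl) (fun z => le_rfl)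
  refine hloc.trans ?_
  -- the profile `κ z := Mv·(𝟙ball·(δ₁ + δ₂))`, the off-ball term vanishing on the support of `Br`
  have hprof := klpr_sum_norm_rate_mul_profile_le β μ K hK hβ hβL n ht Φ hΦ Wd hWd Br hBr hj Qm cen ρw (fun w => Mv * A w) hρw
    (fun w => mul_nonneg hM0 (hA w)) (mul_nonneg hM0 hε)
    (fun z => (if z.1 ∈ klBall L μ 0 then
        ‖V j t ![(((omega0 M, z.1), 0), 0), ((((omega0 M).rev, Qm - z.1), 1), 0), ((((omega0 M).rev, Qm - x), 1), 1), (((omega0 M, x), 0), 1)] -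
            V j t ![(((z.2, z.1), 0), 0), (((z.2.rev, Qm - z.1), 1), 0), ((((omega0 M).rev, Qm - x), 1), 1), (((omega0 M, x), 0), 1)]‖ * Mv +
          Mv * ‖V j t ![(((omega0 M, y), 0), 0), ((((omega0 M).rev, Qm - y), 1), 0), ((((omega0 M).rev, Qm - z.1), 1), 1), (((omega0 M, z.1), 0), 1)] -
            V j t ![(((omega0 M, y), 0), 0), ((((omega0 M).rev, Qm - y), 1), 0), (((z.2.rev, Qm - z.1), 1), 1), (((z.2, z.1), 0), 1)]‖ else 0) +
        (if z.1 ∈ klBall L μ 0 then 0 else Mv * Mv))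
    (fun z hz => ?_)
  · refine hprof.trans (le_of_eq ?_)
    rw [mul_add, Finset.mul_sum]
    congr 1
    · ring
    · exact sum_congr rfl fun w _ => by ring
  · have hball := klpr_mem_ball_of_rate_ne_zero β μ K n ht hKA hA₀ Φ hΦ Wd hWd Br hBr hj Qm hz
    have hband := klpr_sq_le_of_rate_ne_zero β μ K n ht Φ Wd hWd Br hBr j Qm hz
    have h := mul_le_mul_of_nonneg_left (hpin z hball hband) hM0
    rw [if_pos hball, if_pos hball, add_zero]
    calc _ = Mv * (‖V j t ![(((omega0 M, z.1), 0), 0), ((((omega0 M).rev, Qm - z.1), 1), 0), ((((omega0 M).rev, Qm - x), 1), 1), (((omega0 M, x), 0), 1)] -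
            V j t ![(((z.2, z.1), 0), 0), (((z.2.rev, Qm - z.1), 1), 0), ((((omega0 M).rev, Qm - x), 1), 1), (((omega0 M, x), 0), 1)]‖ +
          ‖V j t ![(((omega0 M, y), 0), 0), ((((omega0 M).rev, Qm - y), 1), 0), ((((omega0 M).rev, Qm - z.1), 1), 1), (((omega0 M, z.1), 0), 1)] -
            V j t ![(((omega0 M, y), 0), 0), ((((omega0 M).rev, Qm - y), 1), 0), (((z.2.rev, Qm - z.1), 1), 1), (((z.2, z.1), 0), 1)]‖) := by ring
      _ ≤ Mv * (ε + ∑ w, (if klTorusNorm L (z.1 - cen w) ≤ ρw w then A w else 0)) := h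
      _ = Mv * ε + ∑ w, (if klTorusNorm L (z.1 - cen w) ≤ ρw w then Mv * A w else 0) := by
          rw [mul_add, Finset.mul_sum]
          exact congrArg _ (sum_congr rfl fun w _ => by split_ifs <;> simp)

end Summit.HubbardSuperconductivity.HubbardSuperconductivity.Theorems.KLRegimeSplit

end
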